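import Mathlib

/-!
# PercRepro — the profile PRICE and its surpluses under deletion / contraction (p10, gen 0; S5, Proposition 2, the arithmetic half)

`proofs/SUBCLAIM-S5-p10.md` §2.4, Proposition 2 (A), (B): the MIXED-ANTICHAIN profile price of a set `B` with
`b = ρ(B)`, `p′ = ρ(E ∖ B)` at level `u` is

  `cpr b p′ u := 1` if `b = u`;  `C(b+p′, u)/C(b+p′, b)` if `b < u ≤ p′`;  `0` otherwise,

and the four inequalities below say that the price of `B` in `M` is paid by the prices of `B` in `M ＼ {e}` (level `u`)
and `M ／ {e}` (level `u − 1`) in every regime of a non-loop `e ∉ B` (`ε = [e ∉ cl(E − e − B)]`, `δ = [e ∈ cl B]`),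
and by the price of `B ∖ {e}` in `M ／ {e}` when `e ∈ B` (`η = [e ∉ cl(E ∖ B)]`):

* `(A2)` `ε = 1, δ = 0`: `cpr b p′ u ≤ cpr b (p′−1) u + cpr b (p′−1) (u−1)` (Pascal, then `C(m−1,b) ≤ C(m,b)`);
* `(A3)` `ε = 1, δ = 1`: `cpr b p′ u ≤ cpr b (p′−1) u + cpr (b−1) (p′−1) (u−1)` (`(A2)` and `C(m−2,u−1)/C(m−2,b−1) ≥
  C(m−1,u−1)/C(m−1,b)`, which holds because `m − u ≥ b`);
* `(B1)` `η = 1`: `cpr b p′ u ≤ cpr (b−1) p′ (u−1)` (ratio `u/b`);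
* `(B2)` `η = 0`: `cpr b p′ u ≤ cpr (b−1) (p′−1) (u−1)` (ratio `u(m−u)/(b(m−b))`, i.e. `(u−b)(p′−u) ≥ 0`);
the regimes `ε = 0` need no inequality (the `M ＼ {e}` price equals the `M` price).  Pure binomial arithmetic over `ℚ`;
the matroid half is `ProfileMixedStep.lean`.
-/

namespace PercRepro.Skew

open Nat

/-- The mixed-antichain profile price as a function of `(b, p′, u)`. -/
noncomputable def cpr (b p' u : ℕ) : ℚ :=
  if b = u then 1 else if b < u ∧ u ≤ p' then ((b + p').choose u : ℚ) / ((b + p').choose b : ℚ) else 0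

/-- Prices are nonnegative. -/
theorem cpr_nonneg (b p' u : ℕ) : 0 ≤ cpr b p' u := by
  unfold cpr
  split_ifs
  · exact zero_le_one
  · exact div_nonneg (Nat.cast_nonneg _) (Nat.cast_nonneg _)
  · exact le_rfl

/-- A set at its own level has price `1`. -/
theorem cpr_self (b p' : ℕ) : cpr b p' b = 1 := by
  unfold cpr; rw [if_pos rfl]

/-- Below the level and above the threshold the price is the binomial ratio. -/
theorem cpr_of_lt_of_le {b p' u : ℕ} (hb : b < u) (hu : u ≤ p') :
    cpr b p' u = ((b + p').choose u : ℚ) / ((b + p').choose b : ℚ) := by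
  unfold cpr; rw [if_neg hb.ne, if_pos ⟨hb, hu⟩]

/-- Below the threshold the price is `0`. -/
theorem cpr_of_lt_of_gt {b p' u : ℕ} (hb : b < u) (hu : p' < u) : cpr b p' u = 0 := by
  unfold cpr; rw [if_neg hb.ne, if_neg (fun h => absurd h.2 (not_le.2 hu))]

/-- Above the level the price is `0`. -/
theorem cpr_of_gt {b p' u : ℕ} (hb : u < b) : cpr b p' u = 0 := by
  unfold cpr; rw [if_neg hb.ne', if_neg (fun h => absurd h.1 (not_lt.2 hb.le))]

/-- At the threshold `u = p′` the price is `1` (`C(b+u, u) = C(b+u, b)`). -/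
theorem cpr_threshold {b u : ℕ} (hb : b < u) : cpr b u u = 1 := by
  rw [cpr_of_lt_of_le hb le_rfl, Nat.choose_symm_add, div_self]
  exact_mod_cast (Nat.choose_pos (Nat.le_add_left _ _)).ne'

/-! ### The four binomial inequalities, in subtraction-free parameters -/

/-- `(K1)` Pascal then `C(n,b) ≤ C(n+1,b)`: `C(n+1,u+1)/C(n+1,b) ≤ C(n,u+1)/C(n,b) + C(n,u)/C(n,b)` for `b ≤ n`. -/
theorem K1 (n b u : ℕ) (hb : b ≤ n) :
    ((n + 1).choose (u + 1) : ℚ) / ((n + 1).choose b : ℚ) ≤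
      (n.choose (u + 1) : ℚ) / (n.choose b : ℚ) + (n.choose u : ℚ) / (n.choose b : ℚ) := by
  have h1 : (0 : ℚ) < n.choose b := by exact_mod_cast Nat.choose_pos hb
  have h2 : (0 : ℚ) < (n + 1).choose b := by exact_mod_cast Nat.choose_pos (hb.trans (Nat.le_succ n))
  have h3 : (n.choose b : ℚ) ≤ (n + 1).choose b := by exact_mod_cast Nat.choose_le_succ n b
  rw [← add_div, div_le_div_iff₀ h2 h1]
  have hP : ((n + 1).choose (u + 1) : ℚ) = n.choose u + n.choose (u + 1) := by
    exact_mod_cast Nat.choose_succ_succ' n u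
  rw [hP]
  have h4 : (0 : ℚ) ≤ n.choose u + n.choose (u + 1) := by positivity
  nlinarith

/-- `(K2)` for `n ≥ j + k`: `C(n+1,j)/C(n+1,k+1) ≤ C(n,j)/C(n,k)`. -/
theorem K2 (n j k : ℕ) (h : j + k ≤ n) :
    ((n + 1).choose j : ℚ) / ((n + 1).choose (k + 1) : ℚ) ≤ (n.choose j : ℚ) / (n.choose k : ℚ) := by
  have hk : k ≤ n := by omega
  have hj : j ≤ n := by omega
  have h1 : (0 : ℚ) < n.choose k := by exact_mod_cast Nat.choose_pos hk
  have h2 : (0 : ℚ) < (n + 1).choose (k + 1) := by exact_mod_cast Nat.choose_pos (by omega)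
  rw [div_le_div_iff₀ h2 h1]
  -- (n+1)·C(n,k) = C(n+1,k+1)·(k+1) and C(n,j)·(n+1) = C(n+1,j)·(n+1−j)
  have i1 : ((n + 1 : ℕ) : ℚ) * n.choose k = (n + 1).choose (k + 1) * ((k + 1 : ℕ) : ℚ) := by
    exact_mod_cast Nat.add_one_mul_choose_eq n k
  have i2 : (n.choose j : ℚ) * ((n + 1 : ℕ) : ℚ) = (n + 1).choose j * ((n + 1 - j : ℕ) : ℚ) := by
    exact_mod_cast Nat.choose_mul_succ_eq n j
  have hsub : ((n + 1 - j : ℕ) : ℚ) = ((k + 1 : ℕ) : ℚ) + ((n - j - k : ℕ) : ℚ) := by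
    rw [← Nat.cast_add]; congr 1; omega
  have hA : (0 : ℚ) ≤ (n + 1).choose j := Nat.cast_nonneg _
  have hB : (0 : ℚ) ≤ n.choose k := Nat.cast_nonneg _
  have hd : (0 : ℚ) ≤ ((n - j - k : ℕ) : ℚ) := Nat.cast_nonneg _
  have hpos : (0 : ℚ) < ((n + 1 : ℕ) : ℚ) * ((k + 1 : ℕ) : ℚ) := by positivity
  -- multiply the target by (n+1)(k+1) > 0
  have key : ((n + 1).choose j : ℚ) * n.choose k * (((n + 1 : ℕ) : ℚ) * ((k + 1 : ℕ) : ℚ)) ≤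
      (n.choose j : ℚ) * (n + 1).choose (k + 1) * (((n + 1 : ℕ) : ℚ) * ((k + 1 : ℕ) : ℚ)) := by
    calc ((n + 1).choose j : ℚ) * n.choose k * (((n + 1 : ℕ) : ℚ) * ((k + 1 : ℕ) : ℚ))
        = ((n + 1).choose j : ℚ) * ((k + 1 : ℕ) : ℚ) * (((n + 1 : ℕ) : ℚ) * n.choose k) := by ring
      _ = ((n + 1).choose j : ℚ) * ((k + 1 : ℕ) : ℚ) * ((n + 1).choose (k + 1) * ((k + 1 : ℕ) : ℚ)) := by
          rw [i1]
      _ ≤ ((n + 1).choose j : ℚ) * ((n + 1 - j : ℕ) : ℚ) * ((n + 1).choose (k + 1) * ((k + 1 : ℕ) : ℚ)) := by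
          rw [hsub]
          have hX : (0 : ℚ) ≤ ((n + 1).choose (k + 1) : ℚ) * ((k + 1 : ℕ) : ℚ) := by positivity
          have hle : ((n + 1).choose j : ℚ) * ((k + 1 : ℕ) : ℚ) ≤
              ((n + 1).choose j : ℚ) * (((k + 1 : ℕ) : ℚ) + ((n - j - k : ℕ) : ℚ)) := by
            apply mul_le_mul_of_nonneg_left _ hA
            linarith
          exact mul_le_mul_of_nonneg_right hle hX
      _ = (n.choose j : ℚ) * ((n + 1 : ℕ) : ℚ) * ((n + 1).choose (k + 1) * ((k + 1 : ℕ) : ℚ)) := by rw [i2]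
      _ = (n.choose j : ℚ) * (n + 1).choose (k + 1) * (((n + 1 : ℕ) : ℚ) * ((k + 1 : ℕ) : ℚ)) := by ring
  exact le_of_mul_le_mul_right key hpos

/-- `(K3)` for `k ≤ j ≤ n`: `C(n+1,j+1)/C(n+1,k+1) ≤ C(n,j)/C(n,k)`. -/
theorem K3 (n j k : ℕ) (hkj : k ≤ j) (hj : j ≤ n) :
    ((n + 1).choose (j + 1) : ℚ) / ((n + 1).choose (k + 1) : ℚ) ≤ (n.choose j : ℚ) / (n.choose k : ℚ) := by
  have hk : k ≤ n := hkj.trans hj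
  have h1 : (0 : ℚ) < n.choose k := by exact_mod_cast Nat.choose_pos hk
  have h2 : (0 : ℚ) < (n + 1).choose (k + 1) := by exact_mod_cast Nat.choose_pos (by omega)
  rw [div_le_div_iff₀ h2 h1]
  have i1 : ((n + 1 : ℕ) : ℚ) * n.choose k = (n + 1).choose (k + 1) * ((k + 1 : ℕ) : ℚ) := by
    exact_mod_cast Nat.add_one_mul_choose_eq n k
  have i2 : ((n + 1 : ℕ) : ℚ) * n.choose j = (n + 1).choose (j + 1) * ((j + 1 : ℕ) : ℚ) := by
    exact_mod_cast Nat.add_one_mul_choose_eq n j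
  have hpos : (0 : ℚ) < ((n + 1 : ℕ) : ℚ) * ((k + 1 : ℕ) : ℚ) := by positivity
  have hkj' : ((k + 1 : ℕ) : ℚ) ≤ ((j + 1 : ℕ) : ℚ) := by exact_mod_cast Nat.succ_le_succ hkj
  have hA : (0 : ℚ) ≤ (n + 1).choose (j + 1) := Nat.cast_nonneg _
  have hB : (0 : ℚ) ≤ n.choose k := Nat.cast_nonneg _
  have key : ((n + 1).choose (j + 1) : ℚ) * n.choose k * (((n + 1 : ℕ) : ℚ) * ((k + 1 : ℕ) : ℚ)) ≤
      (n.choose j : ℚ) * (n + 1).choose (k + 1) * (((n + 1 : ℕ) : ℚ) * ((k + 1 : ℕ) : ℚ)) := by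
    calc ((n + 1).choose (j + 1) : ℚ) * n.choose k * (((n + 1 : ℕ) : ℚ) * ((k + 1 : ℕ) : ℚ))
        = ((n + 1).choose (j + 1) : ℚ) * ((k + 1 : ℕ) : ℚ) * (((n + 1 : ℕ) : ℚ) * n.choose k) := by ring
      _ = ((n + 1).choose (j + 1) : ℚ) * ((k + 1 : ℕ) : ℚ) * ((n + 1).choose (k + 1) * ((k + 1 : ℕ) : ℚ)) := by
          rw [i1]
      _ ≤ ((n + 1).choose (j + 1) : ℚ) * ((j + 1 : ℕ) : ℚ) * ((n + 1).choose (k + 1) * ((k + 1 : ℕ) : ℚ)) := by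
          have hX : (0 : ℚ) ≤ ((n + 1).choose (k + 1) : ℚ) * ((k + 1 : ℕ) : ℚ) := by positivity
          exact mul_le_mul_of_nonneg_right (mul_le_mul_of_nonneg_left hkj' hA) hX
      _ = ((n + 1 : ℕ) : ℚ) * n.choose j * ((n + 1).choose (k + 1) * ((k + 1 : ℕ) : ℚ)) := by rw [i2]
      _ = (n.choose j : ℚ) * (n + 1).choose (k + 1) * (((n + 1 : ℕ) : ℚ) * ((k + 1 : ℕ) : ℚ)) := by ring
  exact le_of_mul_le_mul_right key hpos

/-- `(K4)` for `k ≤ j`: `C(j+k+d+2, j+1)/C(j+k+d+2, k+1) ≤ C(j+k+d, j)/C(j+k+d, k)` (the ratio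
`u(m−u)/(b(m−b))` with `(u−b)(p′−u) = (j−k)·d ≥ 0`). -/
theorem K4 (j k d : ℕ) (hkj : k ≤ j) :
    ((j + k + d + 2).choose (j + 1) : ℚ) / ((j + k + d + 2).choose (k + 1) : ℚ) ≤
      ((j + k + d).choose j : ℚ) / ((j + k + d).choose k : ℚ) := by
  set n := j + k + d with hn
  have h1 : (0 : ℚ) < n.choose k := by exact_mod_cast Nat.choose_pos (by omega)
  have h2 : (0 : ℚ) < (n + 2).choose (k + 1) := by exact_mod_cast Nat.choose_pos (by omega)
  rw [div_le_div_iff₀ h2 h1]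
  -- P·(j+1)·(k+d+1) = A·(n+2)(n+1) and Q·(k+1)·(j+d+1) = B·(n+2)(n+1)
  have ij1 : ((n + 2 : ℕ) : ℚ) * (n + 1).choose j = (n + 2).choose (j + 1) * ((j + 1 : ℕ) : ℚ) := by
    exact_mod_cast Nat.add_one_mul_choose_eq (n + 1) j
  have ij2 : (n.choose j : ℚ) * ((n + 1 : ℕ) : ℚ) = (n + 1).choose j * ((k + d + 1 : ℕ) : ℚ) := by
    have := Nat.choose_mul_succ_eq n j
    rw [show n + 1 - j = k + d + 1 by omega] at this
    exact_mod_cast this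
  have ik1 : ((n + 2 : ℕ) : ℚ) * (n + 1).choose k = (n + 2).choose (k + 1) * ((k + 1 : ℕ) : ℚ) := by
    exact_mod_cast Nat.add_one_mul_choose_eq (n + 1) k
  have ik2 : (n.choose k : ℚ) * ((n + 1 : ℕ) : ℚ) = (n + 1).choose k * ((j + d + 1 : ℕ) : ℚ) := by
    have := Nat.choose_mul_succ_eq n k
    rw [show n + 1 - k = j + d + 1 by omega] at this
    exact_mod_cast this
  have eP : ((n + 2).choose (j + 1) : ℚ) * ((j + 1 : ℕ) : ℚ) * ((k + d + 1 : ℕ) : ℚ) =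
      (n.choose j : ℚ) * ((n + 2 : ℕ) : ℚ) * ((n + 1 : ℕ) : ℚ) := by
    calc ((n + 2).choose (j + 1) : ℚ) * ((j + 1 : ℕ) : ℚ) * ((k + d + 1 : ℕ) : ℚ)
        = ((n + 2 : ℕ) : ℚ) * (n + 1).choose j * ((k + d + 1 : ℕ) : ℚ) := by rw [ij1]
      _ = ((n + 2 : ℕ) : ℚ) * ((n + 1).choose j * ((k + d + 1 : ℕ) : ℚ)) := by ring
      _ = ((n + 2 : ℕ) : ℚ) * (n.choose j * ((n + 1 : ℕ) : ℚ)) := by rw [ij2]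
      _ = (n.choose j : ℚ) * ((n + 2 : ℕ) : ℚ) * ((n + 1 : ℕ) : ℚ) := by ring
  have eQ : ((n + 2).choose (k + 1) : ℚ) * ((k + 1 : ℕ) : ℚ) * ((j + d + 1 : ℕ) : ℚ) =
      (n.choose k : ℚ) * ((n + 2 : ℕ) : ℚ) * ((n + 1 : ℕ) : ℚ) := by
    calc ((n + 2).choose (k + 1) : ℚ) * ((k + 1 : ℕ) : ℚ) * ((j + d + 1 : ℕ) : ℚ)
        = ((n + 2 : ℕ) : ℚ) * (n + 1).choose k * ((j + d + 1 : ℕ) : ℚ) := by rw [ik1]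
      _ = ((n + 2 : ℕ) : ℚ) * ((n + 1).choose k * ((j + d + 1 : ℕ) : ℚ)) := by ring
      _ = ((n + 2 : ℕ) : ℚ) * (n.choose k * ((n + 1 : ℕ) : ℚ)) := by rw [ik2]
      _ = (n.choose k : ℚ) * ((n + 2 : ℕ) : ℚ) * ((n + 1 : ℕ) : ℚ) := by ring
  -- the weight factor
  set W : ℚ := ((j + 1 : ℕ) : ℚ) * ((k + d + 1 : ℕ) : ℚ) * ((k + 1 : ℕ) : ℚ) * ((j + d + 1 : ℕ) : ℚ) with hW
  have hWpos : 0 < W := by positivity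
  have hA : (0 : ℚ) ≤ n.choose j := Nat.cast_nonneg _
  have hB : (0 : ℚ) ≤ n.choose k := Nat.cast_nonneg _
  have hC : (0 : ℚ) ≤ ((n + 2 : ℕ) : ℚ) * ((n + 1 : ℕ) : ℚ) := by positivity
  have hkey : ((k + 1 : ℕ) : ℚ) * ((j + d + 1 : ℕ) : ℚ) ≤ ((j + 1 : ℕ) : ℚ) * ((k + d + 1 : ℕ) : ℚ) := by
    push_cast
    have hkj' : (k : ℚ) ≤ j := by exact_mod_cast hkj
    have hd : (0 : ℚ) ≤ d := Nat.cast_nonneg _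
    nlinarith [mul_nonneg hd (sub_nonneg.2 hkj')]
  have key : ((n + 2).choose (j + 1) : ℚ) * n.choose k * W ≤ (n.choose j : ℚ) * (n + 2).choose (k + 1) * W := by
    calc ((n + 2).choose (j + 1) : ℚ) * n.choose k * W
        = (((n + 2).choose (j + 1) : ℚ) * ((j + 1 : ℕ) : ℚ) * ((k + d + 1 : ℕ) : ℚ)) * n.choose k *
            (((k + 1 : ℕ) : ℚ) * ((j + d + 1 : ℕ) : ℚ)) := by rw [hW]; ring
      _ = (n.choose j : ℚ) * n.choose k * (((n + 2 : ℕ) : ℚ) * ((n + 1 : ℕ) : ℚ)) *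
            (((k + 1 : ℕ) : ℚ) * ((j + d + 1 : ℕ) : ℚ)) := by rw [eP]; ring
      _ ≤ (n.choose j : ℚ) * n.choose k * (((n + 2 : ℕ) : ℚ) * ((n + 1 : ℕ) : ℚ)) *
            (((j + 1 : ℕ) : ℚ) * ((k + d + 1 : ℕ) : ℚ)) := by
          apply mul_le_mul_of_nonneg_left hkey
          exact mul_nonneg (mul_nonneg hA hB) hC
      _ = (n.choose j : ℚ) * (((n + 2).choose (k + 1) : ℚ) * ((k + 1 : ℕ) : ℚ) * ((j + d + 1 : ℕ) : ℚ)) *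
            (((j + 1 : ℕ) : ℚ) * ((k + d + 1 : ℕ) : ℚ)) := by rw [eQ]; ring
      _ = (n.choose j : ℚ) * (n + 2).choose (k + 1) * W := by rw [hW]; ring
  exact le_of_mul_le_mul_right key hWpos

/-! ### The price inequalities -/

/-- `(A2)`: `ε = 1, δ = 0`. -/
theorem cpr_le_A2 {b p' u : ℕ} (hb : b ≤ u) (hu : u ≤ p') :
    cpr b p' u ≤ cpr b (p' - 1) u + cpr b (p' - 1) (u - 1) := by
  rcases hb.lt_or_eq with hb | rfl
  · -- b < u ≤ p'
    have hp : 1 ≤ p' := by omega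
    obtain ⟨n, rfl⟩ : ∃ n, p' = n + 1 := ⟨p' - 1, by omega⟩
    obtain ⟨v, rfl⟩ : ∃ v, u = v + 1 := ⟨u - 1, by omega⟩
    simp only [Nat.add_sub_cancel]
    rcases (show v + 1 ≤ n + 1 from hu).lt_or_eq with hlt | heq
    · -- u ≤ p' − 1: both minor prices are binomial ratios, Pascal
      have h1 : cpr b (n + 1) (v + 1) = ((b + (n + 1)).choose (v + 1) : ℚ) / ((b + (n + 1)).choose b : ℚ) :=
        cpr_of_lt_of_le hb hu
      have h2 : cpr b n (v + 1) = ((b + n).choose (v + 1) : ℚ) / ((b + n).choose b : ℚ) :=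
        cpr_of_lt_of_le hb (by omega)
      have h3 : cpr b n v = ((b + n).choose v : ℚ) / ((b + n).choose b : ℚ) := by
        rcases (show b ≤ v by omega).lt_or_eq with hbv | rfl
        · exact cpr_of_lt_of_le hbv (by omega)
        · rw [cpr_self, div_self]
          exact_mod_cast (Nat.choose_pos (Nat.le_add_right _ _)).ne'
      rw [h1, h2, h3, show b + (n + 1) = (b + n) + 1 by ring]
      exact K1 (b + n) b v (Nat.le_add_right _ _)
    · -- u = p': the M-price is 1, the contraction price is 1
      have hv : v = n := by omega
      subst hv
      rw [cpr_threshold hb]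
      have h3 : cpr b v v = 1 := by
        rcases (show b ≤ v by omega).lt_or_eq with h | rfl
        · exact cpr_threshold h
        · exact cpr_self _ _
      rw [h3]
      linarith [cpr_nonneg b v (v + 1)]
  · -- b = u: the deletion price is 1
    rw [cpr_self, cpr_self]
    linarith [cpr_nonneg b (p' - 1) (b - 1)]

/-- `(A3)`: `ε = 1, δ = 1` (`b ≥ 1`). -/
theorem cpr_le_A3 {b p' u : ℕ} (hb1 : 1 ≤ b) (hb : b ≤ u) (hu : u ≤ p') :
    cpr b p' u ≤ cpr b (p' - 1) u + cpr (b - 1) (p' - 1) (u - 1) := by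
  rcases hb.lt_or_eq with hb | rfl
  · obtain ⟨n, rfl⟩ : ∃ n, p' = n + 1 := ⟨p' - 1, by omega⟩
    obtain ⟨v, rfl⟩ : ∃ v, u = v + 1 := ⟨u - 1, by omega⟩
    obtain ⟨c, rfl⟩ : ∃ c, b = c + 1 := ⟨b - 1, by omega⟩
    simp only [Nat.add_sub_cancel]
    rcases (show v + 1 ≤ n + 1 from hu).lt_or_eq with hlt | heq
    · -- compare with (A2) through (K2): cpr c n v ≥ cpr (c+1) n v
      have hA2 := cpr_le_A2 (b := c + 1) (p' := n + 1) (u := v + 1) hb.le hu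
      simp only [Nat.add_sub_cancel] at hA2
      have hQ : cpr (c + 1) n v ≤ cpr c n v := by
        rcases (show c + 1 ≤ v by omega).lt_or_eq with hcv | hcv
        · rw [cpr_of_lt_of_le hcv (by omega), cpr_of_lt_of_le (by omega : c < v) (by omega)]
          -- C(c+1+n, v)/C(c+1+n, c+1) ≤ C(c+n, v)/C(c+n, c): (K2) with n := c + n, j := v, k := c
          have := K2 (c + n) v c (by omega)
          rwa [show c + 1 + n = c + n + 1 by ring]
        · -- c + 1 = v: the left price is 1 = right price's... (c < v = c+1): cpr c n (c+1) = C(c+n,c+1)/C(c+n,c)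
          subst hcv
          rw [cpr_self, cpr_of_lt_of_le (Nat.lt_succ_self c) (by omega)]
          -- C(c+n, c+1)/C(c+n, c) ≥ 1 iff C(c+n,c+1) ≥ C(c+n,c): true since c + 1 ≤ n ... (c + 1 < v + 1 ≤ n)
          rw [le_div_iff₀ (by exact_mod_cast Nat.choose_pos (Nat.le_add_right _ _)), one_mul]
          exact_mod_cast Nat.choose_le_succ_of_lt_half_left (by omega : c < (c + n) / 2)
      linarith
    · have hv : v = n := by omega
      subst hv
      rw [cpr_threshold hb]
      have h3 : cpr c v v = 1 := by
        rcases (show c ≤ v by omega).lt_or_eq with h | rfl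
        · exact cpr_threshold h
        · exact cpr_self _ _
      rw [h3]
      linarith [cpr_nonneg (c + 1) v (v + 1)]
  · rw [cpr_self, cpr_self]
    linarith [cpr_nonneg (b - 1) (p' - 1) (b - 1)]

/-- `(B1)`: `η = 1` (`b ≥ 1`). -/
theorem cpr_le_B1 {b p' u : ℕ} (hb1 : 1 ≤ b) (hb : b ≤ u) (hu : u ≤ p') :
    cpr b p' u ≤ cpr (b - 1) p' (u - 1) := by
  rcases hb.lt_or_eq with hb | rfl
  · obtain ⟨v, rfl⟩ : ∃ v, u = v + 1 := ⟨u - 1, by omega⟩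
    obtain ⟨c, rfl⟩ : ∃ c, b = c + 1 := ⟨b - 1, by omega⟩
    simp only [Nat.add_sub_cancel]
    rw [cpr_of_lt_of_le hb hu]
    rcases (show c ≤ v by omega).lt_or_eq with hcv | rfl
    · rw [cpr_of_lt_of_le hcv (by omega)]
      have := K3 (c + p') v c hcv.le (by omega)
      rwa [show c + 1 + p' = c + p' + 1 by ring]
    · rw [cpr_self]
      rw [div_le_one (by exact_mod_cast Nat.choose_pos (Nat.le_add_right _ _))]
  · rw [cpr_self, cpr_self]

/-- `(B2)`: `η = 0` (`b ≥ 1`). -/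
theorem cpr_le_B2 {b p' u : ℕ} (hb1 : 1 ≤ b) (hb : b ≤ u) (hu : u ≤ p') :
    cpr b p' u ≤ cpr (b - 1) (p' - 1) (u - 1) := by
  rcases hb.lt_or_eq with hb | rfl
  · obtain ⟨v, rfl⟩ : ∃ v, u = v + 1 := ⟨u - 1, by omega⟩
    obtain ⟨c, rfl⟩ : ∃ c, b = c + 1 := ⟨b - 1, by omega⟩
    obtain ⟨n, rfl⟩ : ∃ n, p' = n + 1 := ⟨p' - 1, by omega⟩
    simp only [Nat.add_sub_cancel]
    rw [cpr_of_lt_of_le hb hu]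
    rcases (show c ≤ v by omega).lt_or_eq with hcv | rfl
    · rw [cpr_of_lt_of_le hcv (by omega)]
      obtain ⟨d, rfl⟩ : ∃ d, n = v + d := ⟨n - v, by omega⟩
      have := K4 v c d hcv.le
      rwa [show c + 1 + (v + d + 1) = v + c + d + 2 by ring, show c + (v + d) = v + c + d by ring]
    · rw [cpr_self]
      rw [div_le_one (by exact_mod_cast Nat.choose_pos (Nat.le_add_right _ _))]
  · rw [cpr_self, cpr_self]

end PercRepro.Skew
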